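import Literature.NumberTheory.GaloisRepresentations.ContinuousShapiroOpenCoinducedUntwist
import Literature.NumberTheory.GaloisRepresentations.ContinuousCohomologyAdditiveTransport
import Mathlib.Algebra.Module.ZMod
import Mathlib.GroupTheory.SpecificGroups.Cyclic
import Mathlib.LinearAlgebra.Matrix.ToLin
import HarnessLib

/-!
# Every `W`-trivial `𝔽_p[G]`-module is a matrix twist of `μ_p` (Milne ADT I, proof of Thm. 5.1)

Topic `NumberTheory/GaloisRepresentations`; namespace `Literature.NumberTheory.GaloisRepresentations`
(dot notation under `ContinuousRep`).  Definitions with bodies and theorems; no named fact, no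
`sorry`, no instance, no notation.

Let `G` be a compact group, `W ⊴ G` open normal, `ρ` a continuous representation of `G` on a
discrete abelian group `A` of prime order `p` on which `W` acts trivially ("`μ_p`", `e : ZMod p ≃+ A`
a generator), and `τ` a continuous representation on a discrete `𝔽_p`-module `M`
(`[Module (ZMod p) M]`, basis `bv : Fin d → M`) on which `W` acts trivially.  Then:

* §1 the **mod-`p` character** of `ρ`: integers `ρ.cyclChar e g` with `ρ g v = cyclChar g • v`
  (`apply_eq_cyclChar_smul`), multiplicative modulo `p` (`cast_cyclChar_mul`, `cast_cyclChar_one`,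
  `cast_cyclChar_of_mem`);
* §2 the **untwisted representation** `M′ = M ⊗ μ_p^{⊗-1}`: `ρ.untwistRep τ W e … : Representation ℤ (G ⧸ W) M`,
  `c ↦ cyclChar(g⁻¹) • τ g` (`g` any lift of `c`; `untwistRep_mk`);
* §3 for matrices `a : G ⧸ W → Matrix (Fin d) (Fin d) ℤ` of `M′` in the basis `bv`
  (`hσ : untwistRep c (bv j) = Σ_i a c i j • bv i`, the hypothesis shape of
  `RepresentationTheory/FiniteGroups/TensorCoordinatesModP`) the coordinate map
  **`Θ m = (e (bv.repr m i))ᵢ : M ≃+ (Fin d → A)` intertwines `τ` with the matrix twist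
  `ρ.piTwist W hW a …`** (`(g x) i = Σ_j a(ḡ) i j • ρ g (x j)`, `ContinuousShapiroOpenCoinducedUntwist`):
  `twistCoord_rep`; hence **`Hⁿ(G, M) ≃+ Hⁿ(G, piTwist)`** and
  `natCard_continuousCohomology_eq_piTwist`, with `Nat.card M = p ^ d`.

So "`M ≅ μ_p ⊗ M′` with `M′ := M ⊗ μ_p^{⊗-1}`" in coordinates: the reduction that lets the cyclic
prime-to-`p` base case of Tate's global Euler characteristic formula be computed on twists of
`μ_p` (lane «TATE-EPC-TC», cell `bsd-eis`, stmt-BirchSwinnertonDyer-19032, brick B8-alg (E2b)).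
HONEST FRAMING: module bookkeeping only; no arithmetic statement and no case of BSD is proved here.

## References
* J. S. Milne, *Arithmetic Duality Theorems*, 2nd ed. (2006), I Lemma 5.4, proof of Thm. 5.1 (p. 69). [MilneADT2006]
* J.-P. Serre, *Corps locaux* / *Local Fields* (1979), VII §5. [SerreLocalFields1979]
-/

noncomputable section

open CategoryTheory Function
open scoped Topology

universe u

namespace Literature.NumberTheory.GaloisRepresentations

open _root_.TopRep _root_.ContRepresentation _root_.ContinuousCohomology

namespace ContinuousRep

/-! ## §1 The mod-`p` character of a representation on a group of order `p` -/

section ZModGen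

variable {A : Type u} [AddCommGroup A] {p : ℕ} [Fact p.Prime] (e : ZMod p ≃+ A)

/-- An additive `e : ZMod p → A` is determined by `e 1`: `e k = k.val • e 1`.
[cite: SerreLocalFields1979, VII §5] -/
theorem addEquiv_zmod_apply (k : ZMod p) : e k = (k.val : ℤ) • e 1 := by
  haveI : NeZero p := ⟨(Fact.out : p.Prime).ne_zero⟩
  conv_lhs => rw [← ZMod.natCast_zmod_val k, ← nsmul_one k.val]
  rw [map_nsmul, natCast_zsmul]

/-- `e ((z : ZMod p) * k) = z • e k`. [cite: SerreLocalFields1979, VII §5] -/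
theorem addEquiv_zmod_intCast_mul (z : ℤ) (k : ZMod p) : e ((z : ZMod p) * k) = z • e k := by
  rw [← zsmul_eq_mul, map_zsmul]

/-- `z • e 1 = z' • e 1` forces `z ≡ z' (mod p)`. [cite: SerreLocalFields1979, VII §5] -/
theorem intCast_eq_of_zsmul_eq {z z' : ℤ} (h : z • e 1 = z' • e 1) : (z : ZMod p) = (z' : ZMod p) := by
  apply e.injective
  have h1 := addEquiv_zmod_intCast_mul e z 1
  have h2 := addEquiv_zmod_intCast_mul e z' 1
  rw [mul_one] at h1 h2
  rw [h1, h2]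
  exact h

end ZModGen

section CyclChar

variable {G : Type u} [Group G] [TopologicalSpace G]
variable {A : Type u} [AddCommGroup A] [TopologicalSpace A]
variable (ρ : ContinuousRep G ℤ A) {p : ℕ} [Fact p.Prime] (e : ZMod p ≃+ A)

/-- **The mod-`p` character of `ρ`** (as integers in `[0, p)`): `ρ g (e 1) = cyclChar g • e 1`.
[cite: MilneADT2006, I proof of Thm. 5.1] -/
def cyclChar (g : G) : ℤ := ((e.symm (ρ g (e 1))).val : ℤ)

/-- `ρ g` is multiplication by `cyclChar g`. [cite: MilneADT2006, I proof of Thm. 5.1] -/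
theorem apply_eq_cyclChar_smul (g : G) (v : A) : ρ g v = ρ.cyclChar e g • v := by
  have h1 : ρ g (e 1) = ρ.cyclChar e g • e 1 := by
    conv_lhs => rw [← e.apply_symm_apply (ρ g (e 1))]
    exact addEquiv_zmod_apply e _
  have hv : v = ((e.symm v).val : ℤ) • e 1 := by
    conv_lhs => rw [← e.apply_symm_apply v]
    exact addEquiv_zmod_apply e _
  rw [hv, map_zsmul, h1, smul_comm]

/-- Multiplicativity modulo `p`. [cite: MilneADT2006, I proof of Thm. 5.1] -/
theorem cast_cyclChar_mul (g h : G) :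
    ((ρ.cyclChar e (g * h) : ℤ) : ZMod p) = (ρ.cyclChar e g : ZMod p) * (ρ.cyclChar e h : ZMod p) := by
  rw [← Int.cast_mul]
  refine intCast_eq_of_zsmul_eq e ?_
  rw [← ρ.apply_eq_cyclChar_smul e (g * h) (e 1), map_mul, mul_smul,
    ← ρ.apply_eq_cyclChar_smul e h (e 1), ← ρ.apply_eq_cyclChar_smul e g (ρ h (e 1))]
  rfl

/-- `cyclChar 1 ≡ 1`. [cite: MilneADT2006, I proof of Thm. 5.1] -/
theorem cast_cyclChar_one : ((ρ.cyclChar e 1 : ℤ) : ZMod p) = 1 := by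
  rw [← Int.cast_one]
  refine intCast_eq_of_zsmul_eq e ?_
  rw [← ρ.apply_eq_cyclChar_smul e 1 (e 1), map_one, one_smul]
  rfl

/-- Elements acting trivially have character `≡ 1`. [cite: MilneADT2006, I proof of Thm. 5.1] -/
theorem cast_cyclChar_of_apply_eq {g : G} (hg : ∀ v : A, ρ g v = v) :
    ((ρ.cyclChar e g : ℤ) : ZMod p) = 1 := by
  rw [← Int.cast_one]
  refine intCast_eq_of_zsmul_eq e ?_
  rw [← ρ.apply_eq_cyclChar_smul e g (e 1), hg, one_smul]

/-- `cyclChar g · cyclChar g⁻¹ ≡ 1`. [cite: MilneADT2006, I proof of Thm. 5.1] -/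
theorem cast_cyclChar_mul_inv (g : G) :
    (ρ.cyclChar e g : ZMod p) * (ρ.cyclChar e g⁻¹ : ZMod p) = 1 := by
  rw [← ρ.cast_cyclChar_mul e g g⁻¹, mul_inv_cancel, cast_cyclChar_one]

end CyclChar

/-! ## §2 The untwisted representation `M′ = M ⊗ μ_p^{⊗-1}` of `G ⧸ W` -/

section ZModModule

variable {M : Type u} [AddCommGroup M] (p : ℕ) [Module (ZMod p) M]

/-- On an `𝔽_p`-module an integer acts through its residue. [cite: SerreLocalFields1979, VII §5] -/
theorem zsmul_eq_cast_smul (z : ℤ) (m : M) : z • m = (z : ZMod p) • m :=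
  (Int.cast_smul_eq_zsmul (ZMod p) z m).symm

/-- `p` kills an `𝔽_p`-module (the `ℤ`-scalar form). [cite: SerreLocalFields1979, VII §5] -/
theorem natCast_zsmul_eq_zero_of_module (m : M) : (p : ℤ) • m = 0 := by
  rw [zsmul_eq_cast_smul p, Int.cast_natCast, ZMod.natCast_self, zero_smul]

end ZModModule

section Untwist

variable {G : Type u} [Group G] [TopologicalSpace G]
variable {A : Type u} [AddCommGroup A] [TopologicalSpace A]
variable {M : Type u} [AddCommGroup M] [TopologicalSpace M] {p : ℕ} [Fact p.Prime] [Module (ZMod p) M]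
variable (ρ : ContinuousRep G ℤ A) (τ : ContinuousRep G ℤ M) (W : Subgroup G) [W.Normal]
  (e : ZMod p ≃+ A)
  (hWA : ∀ w ∈ W, ∀ v : A, ρ w v = v) (hWM : ∀ w ∈ W, ∀ m : M, τ w m = m)

/-- The untwisted action of `G` on `M`: `g ↦ cyclChar(g⁻¹) • τ g`, a representation because `M`
is an `𝔽_p`-module and `cyclChar` is multiplicative mod `p`. [cite: MilneADT2006, I proof of Thm. 5.1] -/
def untwistRepG : Representation ℤ G M where
  toFun g := ρ.cyclChar e g⁻¹ • (τ g : M →ₗ[ℤ] M)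
  map_one' := LinearMap.ext fun m => by
    rw [LinearMap.smul_apply, inv_one, map_one, Module.End.one_apply, zsmul_eq_cast_smul p,
      cast_cyclChar_one, one_smul]
  map_mul' g h := LinearMap.ext fun m => by
    simp only [Module.End.mul_apply, LinearMap.smul_apply, map_zsmul, map_mul, mul_inv_rev, smul_smul]
    rw [zsmul_eq_cast_smul p, zsmul_eq_cast_smul p, Int.cast_mul, cast_cyclChar_mul]

/-- Formula. [cite: MilneADT2006, I proof of Thm. 5.1] -/
@[simp] theorem untwistRepG_apply (g : G) (m : M) :
    ρ.untwistRepG τ e g m = ρ.cyclChar e g⁻¹ • τ g m := rfl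

omit [W.Normal] in
include hWA hWM in
/-- `W` acts trivially through the untwisted action. [cite: MilneADT2006, I proof of Thm. 5.1] -/
theorem untwistRepG_eq_one_of_mem (w : G) (hw : w ∈ W) : ρ.untwistRepG τ e w = 1 :=
  LinearMap.ext fun m => by
    rw [untwistRepG_apply, hWM w hw, zsmul_eq_cast_smul p,
      ρ.cast_cyclChar_of_apply_eq e (hWA w⁻¹ (inv_mem hw)), one_smul, Module.End.one_apply]

/-- **The untwisted representation `M′` of `Δ = G ⧸ W` on `M`.** [cite: MilneADT2006, I proof of Thm. 5.1] -/
def untwistRep : Representation ℤ (G ⧸ W) M :=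
  QuotientGroup.lift W (ρ.untwistRepG τ e) fun w hw => ρ.untwistRepG_eq_one_of_mem τ W e hWA hWM w hw

/-- Formula on representatives: `untwistRep ḡ m = cyclChar(g⁻¹) • τ g m`. [cite: MilneADT2006, I proof of Thm. 5.1] -/
@[simp] theorem untwistRep_mk (g : G) (m : M) :
    ρ.untwistRep τ W e hWA hWM (g : G ⧸ W) m = ρ.cyclChar e g⁻¹ • τ g m := rfl

/-- Undoing the untwist: `cyclChar g • untwistRep ḡ m = τ g m`. [cite: MilneADT2006, I proof of Thm. 5.1] -/
theorem cyclChar_smul_untwistRep_mk (g : G) (m : M) :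
    (ρ.cyclChar e g : ZMod p) • ρ.untwistRep τ W e hWA hWM (g : G ⧸ W) m = τ g m := by
  rw [untwistRep_mk, zsmul_eq_cast_smul p, smul_smul, cast_cyclChar_mul_inv, one_smul]

end Untwist

/-! ## §3 Coordinates: `M ≃+ (Fin d → A)` intertwining `τ` with the matrix twist of `ρ` -/

section Coord

variable {G : Type u} [Group G] [TopologicalSpace G]
variable {A : Type u} [AddCommGroup A] [TopologicalSpace A]
variable {M : Type u} [AddCommGroup M] [TopologicalSpace M] {p : ℕ} [Fact p.Prime]
  [Module (ZMod p) M] {d : ℕ}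
variable (ρ : ContinuousRep G ℤ A) (τ : ContinuousRep G ℤ M) (W : Subgroup G) [W.Normal]
  (hW : IsOpen (W : Set G)) (e : ZMod p ≃+ A) (bv : Module.Basis (Fin d) (ZMod p) M)
  (hWA : ∀ w ∈ W, ∀ v : A, ρ w v = v) (hWM : ∀ w ∈ W, ∀ m : M, τ w m = m)
  (a : G ⧸ W → Matrix (Fin d) (Fin d) ℤ)
  (ha1 : ∀ x : Fin d → A, matAct (a 1) x = x)
  (hamul : ∀ (c c' : G ⧸ W) (x : Fin d → A), matAct (a (c * c')) x = matAct (a c) (matAct (a c') x))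
  (hσ : ∀ (c : G ⧸ W) (j : Fin d), ρ.untwistRep τ W e hWA hWM c (bv j) = ∑ i, a c i j • bv i)

omit [TopologicalSpace A] [TopologicalSpace M] in
/-- **The coordinate map `Θ m = (e (bv.repr m i))ᵢ : M ≃+ (Fin d → A)`.** [cite: MilneADT2006, I Lemma 5.4] -/
def twistCoord : M ≃+ (Fin d → A) :=
  bv.equivFun.toAddEquiv.trans (AddEquiv.piCongrRight fun _ => e)

omit [TopologicalSpace A] [TopologicalSpace M] in
/-- Formula. [cite: MilneADT2006, I Lemma 5.4] -/
@[simp] theorem twistCoord_apply (m : M) (i : Fin d) : twistCoord e bv m i = e (bv.repr m i) := by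
  simp [twistCoord]

include hσ in
/-- Coordinates of the untwisted action: `repr (untwistRep c m) i = Σ_j a c i j · repr m j`.
[cite: MilneADT2006, I Lemma 5.4] -/
theorem repr_untwistRep (c : G ⧸ W) (m : M) (i : Fin d) :
    bv.repr (ρ.untwistRep τ W e hWA hWM c m) i = ∑ j, (a c i j : ZMod p) * bv.repr m j := by
  -- the untwisted action as an `𝔽_p`-linear map and its matrix
  let L : M →ₗ[ZMod p] M := ((ρ.untwistRep τ W e hWA hWM c).toAddMonoidHom).toZModLinearMap p
  have hL : ∀ m, L m = ρ.untwistRep τ W e hWA hWM c m := fun _ => rfl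
  have hmat : LinearMap.toMatrix bv bv L = (a c).map (Int.cast : ℤ → ZMod p) := by
    ext i' j'
    rw [LinearMap.toMatrix_apply, hL, hσ, Matrix.map_apply]
    simp_rw [zsmul_eq_cast_smul p]
    rw [bv.repr_sum_self]
  have hvec := LinearMap.toMatrix_mulVec_repr bv bv L m
  rw [hmat, hL] at hvec
  rw [← hvec]
  rfl

include hσ in
/-- Coordinates of `τ g m`: `repr (τ g m) i = cyclChar g · Σ_j a ḡ i j · repr m j`.
[cite: MilneADT2006, I Lemma 5.4] -/
theorem repr_apply (g : G) (m : M) (i : Fin d) :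
    bv.repr (τ g m) i =
      (ρ.cyclChar e g : ZMod p) * ∑ j, (a (g : G ⧸ W) i j : ZMod p) * bv.repr m j := by
  rw [← ρ.cyclChar_smul_untwistRep_mk τ W e hWA hWM g m, map_smul, Finsupp.smul_apply, smul_eq_mul,
    repr_untwistRep ρ τ W e bv hWA hWM a hσ]

include hσ in
/-- **Equivariance: `Θ (τ g m) = (ρ.piTwist W hW a …) g (Θ m)`.** [cite: MilneADT2006, I Lemma 5.4] -/
theorem twistCoord_rep [IsTopologicalGroup G] [DiscreteTopology A] (g : G) (m : M) :
    twistCoord e bv (τ g m) = ρ.piTwist W hW a ha1 hamul g (twistCoord e bv m) := by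
  funext i
  rw [piTwist_apply, matAct_apply, twistCoord_apply, repr_apply ρ τ W e bv hWA hWM a hσ,
    addEquiv_zmod_intCast_mul, map_sum, Finset.smul_sum]
  refine Finset.sum_congr rfl fun j _ => ?_
  rw [addEquiv_zmod_intCast_mul, twistCoord_apply, ρ.apply_eq_cyclChar_smul e, smul_comm]

end Coord

/-! ## §4 On cohomology -/

section Cohomology

variable {G : Type u} [Group G] [TopologicalSpace G] [IsTopologicalGroup G]
variable {A : Type u} [AddCommGroup A] [TopologicalSpace A] [DiscreteTopology A]
variable {M : Type u} [AddCommGroup M] [TopologicalSpace M] [DiscreteTopology M] {p : ℕ} [Fact p.Prime]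
  [Module (ZMod p) M] {d : ℕ}
variable (ρ : ContinuousRep G ℤ A) (τ : ContinuousRep G ℤ M) (W : Subgroup G) [W.Normal]
  (hW : IsOpen (W : Set G)) (e : ZMod p ≃+ A) (bv : Module.Basis (Fin d) (ZMod p) M)
  (hWA : ∀ w ∈ W, ∀ v : A, ρ w v = v) (hWM : ∀ w ∈ W, ∀ m : M, τ w m = m)
  (a : G ⧸ W → Matrix (Fin d) (Fin d) ℤ)
  (ha1 : ∀ x : Fin d → A, matAct (a 1) x = x)
  (hamul : ∀ (c c' : G ⧸ W) (x : Fin d → A), matAct (a (c * c')) x = matAct (a c) (matAct (a c') x))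
  (hσ : ∀ (c : G ⧸ W) (j : Fin d), ρ.untwistRep τ W e hWA hWM c (bv j) = ∑ i, a c i j • bv i)

/-- The coordinate map as a homeomorphism (both sides discrete). [cite: MilneADT2006, I Lemma 5.4] -/
def twistCoordHomeo : M ≃ₜ+ (Fin d → A) :=
  { twistCoord e bv with
    continuous_toFun := continuous_of_discreteTopology
    continuous_invFun := continuous_of_discreteTopology }

/-- Formula. [cite: MilneADT2006, I Lemma 5.4] -/
@[simp] theorem twistCoordHomeo_apply (m : M) : twistCoordHomeo e bv m = twistCoord e bv m := rfl

include hσ in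
/-- **`Hⁿ(G, M) ≃+ Hⁿ(G, μ_p-twist in coordinates)`.** [cite: MilneADT2006, I Lemma 5.4, proof of Thm. 5.1] -/
def continuousCohomologyTwistEquiv (n : ℕ) :
    (continuousCohomology n τ.toTopRep : Type u) ≃+
      (continuousCohomology n (ρ.piTwist W hW a ha1 hamul).toTopRep : Type u) :=
  continuousCohomologyAddEquiv (X := τ.toTopRep) (Y := (ρ.piTwist W hW a ha1 hamul).toTopRep)
    (twistCoordHomeo e bv) (fun g m => twistCoord_rep ρ τ W hW e bv hWA hWM a ha1 hamul hσ g m) n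

include hσ in
/-- **`#Hⁿ(G, M) = #Hⁿ(G, μ_p-twist)`.** [cite: MilneADT2006, I Lemma 5.4, proof of Thm. 5.1] -/
theorem natCard_continuousCohomology_eq_piTwist (n : ℕ) :
    Nat.card (continuousCohomology n τ.toTopRep) =
      Nat.card (continuousCohomology n (ρ.piTwist W hW a ha1 hamul).toTopRep) :=
  Nat.card_congr (ρ.continuousCohomologyTwistEquiv τ W hW e bv hWA hWM a ha1 hamul hσ n).toEquiv

omit [TopologicalSpace G] [IsTopologicalGroup G] [TopologicalSpace A]
  [DiscreteTopology A] [TopologicalSpace M] [DiscreteTopology M] in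
include e bv in
/-- `#M = p ^ d = #(Fin d → A)`. [cite: MilneADT2006, I proof of Thm. 5.1] -/
theorem natCard_eq_pow_of_basis : Nat.card M = p ^ d ∧ Nat.card (Fin d → A) = p ^ d := by
  have hA : Nat.card A = p := by rw [← Nat.card_congr e.toEquiv, Nat.card_zmod]
  refine ⟨?_, ?_⟩
  · rw [Nat.card_congr bv.equivFun.toEquiv, Nat.card_pi, Nat.card_zmod, Finset.prod_const,
      Finset.card_univ, Fintype.card_fin]
  · rw [Nat.card_pi, hA, Finset.prod_const, Finset.card_univ, Fintype.card_fin]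

end Cohomology

end ContinuousRep

end Literature.NumberTheory.GaloisRepresentations

end
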